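import Literature.AlgebraicGeometry.Morphisms.ProjectiveMorphismComposition
import Literature.AlgebraicGeometry.HodgeTheory.GlobalInvariantCycles
import HarnessLib

/-!
# Quasi-projective morphisms of schemes (Hartshorne's definition) over an arbitrary base

Topic `Literature/AlgebraicGeometry/Morphisms`; sequel of `Morphisms/ProjectiveMorphism`
(`Literature.AlgebraicGeometry.Morphisms.IsProjective`, Hartshorne's projective morphisms =
Stacks' "H-projective") and `Morphisms/ProjectiveMorphismComposition` (base change, composition,
field bridge). Hartshorne, *Algebraic Geometry*, II §4, Definition p. 103: a morphism `f : X → Y` is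
**quasi-projective** if it factors into an open immersion `X → X'` followed by a projective morphism
`X' → Y` (Stacks' "H-quasi-projective", Tag 01VW). This file adds the morphism property and its
formal theory:

* `IsQuasiProjective f` — the definition (a `Prop`; the factorisation is existentially quantified).
* `IsProjective.isQuasiProjective`, `IsQuasiProjective.comp_isOpenImmersion` (an open immersion
  followed by a quasi-projective morphism), `IsQuasiProjective.of_isOpenImmersion_comp_isProjective`.
* `IsQuasiProjective.of_isPullback` — **stable under base change** (Stacks 01VW + 01WF: base-change
  the projective part by `IsProjective.of_isPullback`, the open immersion by Mathlib).
* riders `IsQuasiProjective.isSeparated`, `IsQuasiProjective.locallyOfFiniteType`.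
* `isQuasiProjective_hom_iff_isQuasiProjectiveOver` — **over a field** the morphism-class dialect
  agrees with the tree's `Literature.AlgebraicGeometry.HodgeTheory.IsQuasiProjectiveOver X` (an open
  `k`-immersion into a projective `k`-scheme, `HodgeTheory/GlobalInvariantCycles`), through the
  field bridge `isProjective_hom_iff_isProjectiveOver`.

NOT here (false in this generality): composition of two quasi-projective morphisms (needs an ample
invertible sheaf on the middle scheme; EGA II 5.3.4 (ii) is for EGA-quasi-projective over a
quasi-compact base). Everything is proved; no named facts.

## References

* R. Hartshorne, *Algebraic Geometry*, GTM 52 (1977), II §4 Definition p. 103 (quasi-projective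
  morphism). [Hartshorne1977]
* The Stacks Project, Tag 01VW (Definition 29.40.1, H-quasi-projective), Tag 01WF. [StacksProject]
-/

noncomputable section

universe u

open CategoryTheory CategoryTheory.Limits AlgebraicGeometry

namespace Literature.AlgebraicGeometry.Morphisms

variable {X Y Z : Scheme.{u}}

/-- **Quasi-projective morphism** (Hartshorne II §4, Definition p. 103; Stacks' H-quasi-projective,
Tag 01VW): `f : X → Y` factors as an open immersion `i : X → P` followed by a projective morphism
`p : P → Y` (`Literature.AlgebraicGeometry.Morphisms.IsProjective`).
[cite: Hartshorne1977, II §4 Definition p.103 (projective morphism)] -/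
def IsQuasiProjective (f : X ⟶ Y) : Prop :=
  ∃ (P : Scheme.{u}) (i : X ⟶ P) (p : P ⟶ Y), IsOpenImmersion i ∧ IsProjective p ∧ i ≫ p = f

/-- A projective morphism is quasi-projective (`i = 𝟙`).
[cite: Hartshorne1977, II §4 Definition p.103 (projective morphism)] -/
theorem IsProjective.isQuasiProjective {f : X ⟶ Y} (hf : IsProjective f) : IsQuasiProjective f :=
  ⟨X, 𝟙 X, f, inferInstance, hf, Category.id_comp f⟩

/-- The projection `𝐏(ι; Y) → Y` is quasi-projective. [cite: Hartshorne1977, II §4 Definition p.103 (projective morphism)] -/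
theorem isQuasiProjective_projectiveSpaceFst (ι : Type u) [Finite ι] (Y : Scheme.{u}) :
    IsQuasiProjective (projectiveSpaceFst ι Y) :=
  (isProjective_projectiveSpaceFst ι Y).isQuasiProjective

/-- An open immersion followed by a projective morphism is quasi-projective (the definition).
[cite: Hartshorne1977, II §4 Definition p.103 (projective morphism)] -/
theorem IsQuasiProjective.of_isOpenImmersion_comp_isProjective {P : Scheme.{u}} (i : X ⟶ P)
    [IsOpenImmersion i] {p : P ⟶ Y} (hp : IsProjective p) : IsQuasiProjective (i ≫ p) :=
  ⟨P, i, p, inferInstance, hp, rfl⟩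

/-- **An open immersion followed by a quasi-projective morphism is quasi-projective** (open
immersions compose). [cite: Hartshorne1977, II §4 Definition p.103 (projective morphism)] -/
theorem IsQuasiProjective.comp_isOpenImmersion {W : Scheme.{u}} {f : X ⟶ Y} (hf : IsQuasiProjective f)
    (g : W ⟶ X) [IsOpenImmersion g] : IsQuasiProjective (g ≫ f) := by
  obtain ⟨P, i, p, hi, hp, hipf⟩ := hf
  exact ⟨P, g ≫ i, p, inferInstance, hp, by rw [Category.assoc, hipf]⟩

/-- **An open subscheme of a quasi-projective `Y`-scheme is quasi-projective over `Y`**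
(`comp_isOpenImmersion` for `U.ι`). [cite: Hartshorne1977, II §4 Definition p.103 (projective morphism)] -/
theorem IsQuasiProjective.ι_comp {f : X ⟶ Y} (hf : IsQuasiProjective f) (U : X.Opens) :
    IsQuasiProjective (U.ι ≫ f) :=
  hf.comp_isOpenImmersion U.ι

/-- **Quasi-projective morphisms are stable under base change** (Stacks 01VW with 01WF (1)): if
`f = i ≫ p` with `i` an open immersion and `p` projective, and `X' = Y' ×_Y X`, then
`X' → Y' ×_Y P → Y'` is an open immersion (base change of `i`) followed by a projective morphism
(`IsProjective.of_isPullback`). [cite: StacksProject, Tag 01VW] -/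
theorem IsQuasiProjective.of_isPullback {X' Y' : Scheme.{u}} {f : X ⟶ Y} {f' : X' ⟶ Y'} {u' : X' ⟶ X}
    {u : Y' ⟶ Y} (h : IsPullback u' f' f u) (hf : IsQuasiProjective f) : IsQuasiProjective f' := by
  obtain ⟨P, i, p, hi, hp, hipf⟩ := hf
  -- base change of `p`
  have hP : IsPullback (pullback.fst p u) (pullback.snd p u) p u := IsPullback.of_hasPullback p u
  have hw : (u' ≫ i) ≫ p = f' ≫ u := by rw [Category.assoc, hipf]; exact h.w
  -- the open immersion `X' → Y' ×_Y P`, base change of `i`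
  have hs : IsPullback u' (hP.lift (u' ≫ i) f' hw ≫ pullback.snd p u) (i ≫ p) u := by
    rw [hP.lift_snd, hipf]
    exact h
  have htop : IsPullback u' (hP.lift (u' ≫ i) f' hw) i (pullback.fst p u) :=
    IsPullback.of_bot hs (hP.lift_fst _ _ _).symm hP
  haveI : IsOpenImmersion (hP.lift (u' ≫ i) f' hw) := MorphismProperty.of_isPullback htop hi
  exact ⟨pullback p u, hP.lift (u' ≫ i) f' hw, pullback.snd p u, inferInstance, hp.of_isPullback hP,
    hP.lift_snd _ _ _⟩

/-- The projections of a fibre product with a quasi-projective factor are quasi-projective.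
[cite: StacksProject, Tag 01VW] -/
theorem IsQuasiProjective.pullback_fst {S : Scheme.{u}} (f : X ⟶ S) {g : Y ⟶ S}
    (hg : IsQuasiProjective g) : IsQuasiProjective (pullback.fst f g) :=
  hg.of_isPullback (IsPullback.of_hasPullback f g).flip

/-- The projections of a fibre product with a quasi-projective factor are quasi-projective.
[cite: StacksProject, Tag 01VW] -/
theorem IsQuasiProjective.pullback_snd {S : Scheme.{u}} {f : X ⟶ S} (hf : IsQuasiProjective f)
    (g : Y ⟶ S) : IsQuasiProjective (pullback.snd f g) :=
  hf.of_isPullback (IsPullback.of_hasPullback f g)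

/-- A quasi-projective morphism is separated (open immersions and proper morphisms are).
[cite: Hartshorne1977, II §4 Definition p.103 (projective morphism)] -/
theorem IsQuasiProjective.isSeparated {f : X ⟶ Y} (hf : IsQuasiProjective f) : IsSeparated f := by
  obtain ⟨P, i, p, hi, hp, hipf⟩ := hf
  haveI := hp.isProper
  rw [← hipf]
  infer_instance

/-- A quasi-projective morphism is locally of finite type. [cite: Hartshorne1977, II §4 Definition p.103 (projective morphism)] -/
theorem IsQuasiProjective.locallyOfFiniteType {f : X ⟶ Y} (hf : IsQuasiProjective f) :
    LocallyOfFiniteType f := by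
  obtain ⟨P, i, p, hi, hp, hipf⟩ := hf
  haveI := hp.isProper
  rw [← hipf]
  infer_instance

/-! ### Over a field: agreement with `HodgeTheory.IsQuasiProjectiveOver` -/

section Field

variable {k : Type u} [Field k]

/-- **Over a field, `HodgeTheory.IsQuasiProjectiveOver X` implies `IsQuasiProjective X.hom`.**
[cite: Hartshorne1977, II §4 Definition p.103 (projective morphism)] -/
theorem IsQuasiProjective.of_isQuasiProjectiveOver {X : Motives.SchemeOver k}
    (h : HodgeTheory.IsQuasiProjectiveOver X) : IsQuasiProjective X.hom := by
  obtain ⟨P, j, hP, hj⟩ := h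
  exact ⟨P.left, j.left, P.hom, hj, IsProjective.of_isProjectiveOver hP, Over.w j⟩

/-- **Over a field, `IsQuasiProjective X.hom` implies `HodgeTheory.IsQuasiProjectiveOver X`.**
[cite: Hartshorne1977, II §4 Definition p.103 (projective morphism)] -/
theorem IsQuasiProjective.isQuasiProjectiveOver {X : Motives.SchemeOver k}
    (h : IsQuasiProjective X.hom) : HodgeTheory.IsQuasiProjectiveOver X := by
  obtain ⟨P, i, p, hi, hp, hipf⟩ := h
  exact ⟨Over.mk p, Over.homMk i hipf, (IsProjective.isProjectiveOver (X := Over.mk p) hp), hi⟩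

/-- **Over a field the two notions of quasi-projectivity agree** (the morphism-class dialect vs.
the tree's `HodgeTheory.IsQuasiProjectiveOver`). [cite: Hartshorne1977, II §4 Definition p.103 (projective morphism)] -/
theorem isQuasiProjective_hom_iff_isQuasiProjectiveOver (X : Motives.SchemeOver k) :
    IsQuasiProjective X.hom ↔ HodgeTheory.IsQuasiProjectiveOver X :=
  ⟨IsQuasiProjective.isQuasiProjectiveOver, IsQuasiProjective.of_isQuasiProjectiveOver⟩

end Field

end Literature.AlgebraicGeometry.Morphisms

end
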